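import Literature.NumberTheory.GaloisRepresentations.GaloisRep
import Literature.NumberTheory.GaloisRepresentations.ArtinCharacterReciprocity
import HarnessLib

/-!
# Route C `PrintCf2RubinValueTwo`, crux `GoodTwistDictionaryAtTwo` (stmt-BirchSwinnertonDyer-23295), PART 2 / F1:
# the SIGN CHARACTER of a square root as a rank-one framed Galois representation — unramified away from `2a`,
# Frobenius = Euler's sign `a^{(N w − 1)/2} mod w`

Cell `bsd-print-cf2`, width seat `bsd-line-cf2c-w2` g9 (prover-bsd-line-cf2c-w2-g9-0); Theses-free helper
`--supports stmt-BirchSwinnertonDyer-23295`. THEOREMS ONLY (no `def`, no named fact, no `sorry`); generic algebraic number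
theory (any number field `K`, any coefficient ring `A`); nothing about BSD is asserted; no summit statement is proved by this
seat; BSD is not proved by any of this.

WHY (the (DICT) conjunct of 23295, PART 2 PLAN on HOME STATUS 2026-08-29T18:1xZ): the junction `unitChar θ|_Υ = r′|_Υ` of the
good-twist dictionary is proved by comparing the `2`-adic avatars of the Deuring characters of two members `W ≅ cm7^{(εm)}`,
`W′ ≅ cm7^{(m)}`; they differ by the SIGN CHARACTER `g_ε : σ ↦ σ(√ε)/√ε ∈ {±1}` (`ε ∈ {−1, ±2}`), read at Frobenius elements
(`g_ε(Frob_w) = (ε/p)` at a split `w ∣ p`, `= 1` at an inert one) and on `Υ = Gal(K̄/K̃_∞)` (-w8 g6's H′ table). This file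
supplies `g` for any `a ∈ 𝓞 K`, `r² = a`:

* §1 `smul_eq_self_or_eq_neg_of_sq_eq` — every `σ ∈ Γ_K` maps `r` to `±r`.
* §2 `exists_framedGaloisRep_sign` — for every topological commutative ring `A` there is `g : Γ_K →ₜ* GL₁(A)` with entry `1` at
  the `σ` fixing `r` and `−1` at the others (continuity: the stabiliser of `r` is open, `stabilizer_isOpen_of_isIntegral`).
* §3 `smul_eq_self_of_mem_inertia_of_sq_eq` — for a finite place `w` with `2 ∉ w`, `a ∉ w`, every inertia group `I_𝔓`, `𝔓 ∣ w`,
  fixes `r` (`σ r ≡ r (mod 𝔓)` and `2r ∉ 𝔓` since `(2r)² = 4a ∉ w`); `isUnramifiedAt_of_sign` — such a `g` is unramified at `w`.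
* §4 `smul_eq_sign_smul_of_isArithFrobAt` — **Euler's criterion for Frobenius**: if `N w = 2k + 1` and `a^k ≡ s (mod w)` with
  `s = ±1`, then every arithmetic Frobenius `Φ` at `𝔓 ∣ w` has `Φ r = s·r` (`Φ r ≡ r^{N w} = a^k r ≡ s r (mod 𝔓)`, and again
  `2r ∉ 𝔓`); `hasFrobCharpolyAt_of_sign` — the framed form `g.HasFrobCharpolyAt w (X − C s)`.

References: [IrelandRosen1990] Ch. 5 §1 Prop. 5.1.1 (Euler's criterion), Ch. 14 §2 Prop. 14.2.2 (Frobenius on radicals = power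
residue symbol); [NeukirchANT1999] Ch. I §8 (Hilbert theory: inertia acts trivially on the residue field); [SerreAbelianLadic1968]
Ch. I §2.1 (unramified representations, Frobenius elements).
-/

set_option autoImplicit false
-- D-0017 layout: summit = sub-problem, so `Summit.BirchSwinnertonDyer.BirchSwinnertonDyer.…` repeats a path component.
set_option linter.dupNamespace false

noncomputable section

open scoped Classical Polynomial
open NumberField IsDedekindDomain Field Polynomial
open Literature Literature.NumberTheory.GaloisRepresentations

namespace Summit.BirchSwinnertonDyer.BirchSwinnertonDyer.Theorems.PrintCf2.GoodTwistDictQuadSign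

variable {K : Type} [Field K] [NumberField K]

/-! ## §1 Galois moves a square root to `±` itself -/

omit [NumberField K] in
/-- For `r ∈ K̄` with `r² = a ∈ 𝓞 K`, every `σ ∈ Γ_K` has `σ r = r` or `σ r = −r` (`(σ r)² = a`). [cite: IrelandRosen1990, Ch. 14 §2] -/
theorem smul_eq_self_or_eq_neg_of_sq_eq {a : 𝓞 K} {r : AlgebraicClosure K}
    (hr : r ^ 2 = algebraMap (𝓞 K) (AlgebraicClosure K) a) (σ : absoluteGaloisGroup K) : σ • r = r ∨ σ • r = -r := by
  apply sq_eq_sq_iff_eq_or_eq_neg.mp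
  rw [← smul_pow', hr, Field.absoluteGaloisGroup.smul_def, IsScalarTower.algebraMap_apply (𝓞 K) K (AlgebraicClosure K),
    AlgEquiv.commutes]

omit [NumberField K] in
/-- `r ≠ 0` when `r² = a ≠ 0`. [folklore] -/
theorem ne_zero_of_sq_eq {a : 𝓞 K} (ha : a ≠ 0) {r : AlgebraicClosure K} (hr : r ^ 2 = algebraMap (𝓞 K) (AlgebraicClosure K) a) :
    r ≠ 0 := by
  rintro rfl
  rw [zero_pow two_ne_zero, eq_comm, map_eq_zero_iff _ (FaithfulSMul.algebraMap_injective (𝓞 K) (AlgebraicClosure K))] at hr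
  exact ha hr

/-- `r ≠ −r` when `r² = a ≠ 0` (characteristic `0`). [folklore] -/
theorem self_ne_neg_of_sq_eq {a : 𝓞 K} (ha : a ≠ 0) {r : AlgebraicClosure K}
    (hr : r ^ 2 = algebraMap (𝓞 K) (AlgebraicClosure K) a) : r ≠ -r := fun h ↦
  ne_zero_of_sq_eq ha hr (by
    have h2 : (2 : AlgebraicClosure K) * r = 0 := by linear_combination h
    exact (mul_eq_zero.mp h2).resolve_left two_ne_zero)

/-! ## §2 The sign character as a rank-one framed Galois representation -/

/-- A group homomorphism with open kernel into a topological group with continuous multiplication is continuous. [folklore] -/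
private theorem continuous_of_isOpen_ker {G H : Type*} [Group G] [TopologicalSpace G] [IsTopologicalGroup G] [Group H]
    [TopologicalSpace H] [ContinuousMul H] (f : G →* H) (hf : IsOpen (f.ker : Set G)) : Continuous f := by
  refine continuous_of_continuousAt_one f ?_
  rw [ContinuousAt, map_one]
  refine fun U hU ↦ Filter.mem_map.mpr (Filter.mem_of_superset (hf.mem_nhds (by simp)) ?_)
  intro g hg
  rw [SetLike.mem_coe, MonoidHom.mem_ker] at hg
  rw [Set.mem_preimage, hg]
  exact mem_of_mem_nhds hU

/-- **The sign character of `r = √a` as a rank-one framed Galois representation** over any topological commutative ring `A`: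
there is `g : Γ_K →ₜ* GL₁(A)` whose entry at `σ` is `1` if `σ r = r` and `−1` if `σ r = −r` (the two cases exhaust `Γ_K`, §1).
Continuity: the kernel contains the stabiliser of the algebraic integer `r`, which is open in the Krull topology.
[cite: IrelandRosen1990, Ch. 14 §2] [cite: SerreAbelianLadic1968, Ch. I §2.1] -/
theorem exists_framedGaloisRep_sign (A : Type*) [CommRing A] [TopologicalSpace A] [IsTopologicalRing A]
    {a : 𝓞 K} (ha : a ≠ 0) {r : AlgebraicClosure K} (hr : r ^ 2 = algebraMap (𝓞 K) (AlgebraicClosure K) a) :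
    ∃ g : FramedGaloisRep K A 1, ∀ σ : absoluteGaloisGroup K,
      (σ • r = r → g σ = 1) ∧
      (σ • r = -r → ∀ i j : Fin 1, ((g σ : GL (Fin 1) A) : Matrix (Fin 1) (Fin 1) A) i j = -1) := by
  have hne : r ≠ -r := self_ne_neg_of_sq_eq ha hr
  have hne' : -r ≠ r := fun h ↦ hne h.symm
  have hpm := smul_eq_self_or_eq_neg_of_sq_eq hr
  -- the `Aˣ`-valued sign homomorphism
  let f : absoluteGaloisGroup K →* Aˣ :=
    { toFun := fun σ ↦ if σ • r = r then 1 else -1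
      map_one' := by simp only [one_smul, if_true]
      map_mul' := fun σ τ ↦ by
        by_cases hτ : τ • r = r
        · simp only [mul_smul, hτ, if_true, mul_one]
        · have hτ' : τ • r = -r := (hpm τ).resolve_left hτ
          by_cases hσ : σ • r = r
          · have h1 : (σ * τ) • r = -r := by rw [mul_smul, hτ', smul_neg, hσ]
            simp [h1, hne', hσ, hτ]
          · have hσ' : σ • r = -r := (hpm σ).resolve_left hσ
            have h1 : (σ * τ) • r = r := by rw [mul_smul, hτ', smul_neg, hσ', neg_neg]
            simp [h1, hσ, hτ] }
  have hf : ∀ σ, f σ = if σ • r = r then 1 else -1 := fun σ ↦ rfl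
  -- its kernel contains the (open) stabiliser of `r`
  have hri : IsIntegral (𝓞 K) r := IsIntegral.of_pow two_pos (by rw [hr]; exact isIntegral_algebraMap)
  have hopen : IsOpen (f.ker : Set (absoluteGaloisGroup K)) := by
    refine Subgroup.isOpen_mono (H₁ := MulAction.stabilizer (absoluteGaloisGroup K) (⟨r, hri⟩ : absIntegers (𝓞 K) K)) ?_
      (stabilizer_integralClosure_isOpen (𝓞 K) (K := K) (⟨r, hri⟩ : absIntegers (𝓞 K) K))
    intro σ hσ
    rw [MulAction.mem_stabilizer_iff, Subtype.ext_iff, integralClosure.coe_smul] at hσ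
    rw [MonoidHom.mem_ker, hf, if_pos hσ]
  let χ : absoluteGaloisGroup K →ₜ* Aˣ := ⟨f, continuous_of_isOpen_ker f hopen⟩
  let g : FramedGaloisRep K A 1 :=
    (FramedRep.unitsContinuousMulEquivOfUnique (Fin 1) A : Aˣ →ₜ* GL (Fin 1) A).comp χ
  have hg : ∀ σ, g σ = FramedRep.unitsContinuousMulEquivOfUnique (Fin 1) A (f σ) := fun σ ↦ rfl
  refine ⟨g, fun σ ↦ ⟨fun hσ ↦ ?_, fun hσ i j ↦ ?_⟩⟩
  · rw [hg, hf, if_pos hσ, map_one]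
  · rw [hg, FramedRep.unitsContinuousMulEquivOfUnique_apply_coe, hf, if_neg (fun h ↦ hne (h.symm.trans hσ)), Units.val_neg,
      Units.val_one]

/-! ## §3 Inertia away from `2a` fixes `r`: the sign character is unramified there -/

omit [NumberField K] in
/-- `a ∈ w ↔ a ∈ 𝔓` for `a ∈ 𝓞 K` and a prime `𝔓` of `\bar ℤ_K` above `w`. [folklore] -/
theorem algebraMap_mem_iff_of_mem_primesAbove {w : HeightOneSpectrum (𝓞 K)} {𝔓 : Ideal (absIntegers (𝓞 K) K)}
    (h𝔓 : 𝔓 ∈ w.primesAbove) (a : 𝓞 K) : algebraMap (𝓞 K) (absIntegers (𝓞 K) K) a ∈ 𝔓 ↔ a ∈ w.asIdeal := by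
  rw [h𝔓.2.over, Ideal.mem_under]

omit [NumberField K] in
/-- The key integrality step: if `r² = a` with `2 ∉ w`, `a ∉ w`, and `x = r ∈ \bar ℤ_K`, then `x + x ∉ 𝔓` for every prime `𝔓 ∣ w`
(`(2x)² = 4a ∉ w`). [cite: IrelandRosen1990, Ch. 14 §2 (proof of Prop. 14.2.2)] -/
theorem two_mul_notMem_of_sq_eq {a : 𝓞 K} {w : HeightOneSpectrum (𝓞 K)} (h2 : (2 : 𝓞 K) ∉ w.asIdeal) (ha : a ∉ w.asIdeal)
    {𝔓 : Ideal (absIntegers (𝓞 K) K)} (h𝔓 : 𝔓 ∈ w.primesAbove) {x : absIntegers (𝓞 K) K}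
    (hx : x ^ 2 = algebraMap (𝓞 K) (absIntegers (𝓞 K) K) a) : 2 * x ∉ 𝔓 := by
  haveI : 𝔓.IsPrime := h𝔓.1
  intro hmem
  have h4 : (2 * x) ^ 2 ∈ 𝔓 := 𝔓.pow_mem_of_mem hmem 2 two_pos
  rw [mul_pow, hx, show ((2 : absIntegers (𝓞 K) K)) ^ 2 = algebraMap (𝓞 K) (absIntegers (𝓞 K) K) (2 ^ 2) by
    rw [map_pow, map_ofNat], ← map_mul, algebraMap_mem_iff_of_mem_primesAbove h𝔓] at h4
  rcases w.isPrime.mem_or_mem h4 with h | h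
  · exact h2 (w.isPrime.mem_of_pow_mem 2 h)
  · exact ha h

omit [NumberField K] in
/-- **Inertia away from `2a` fixes `√a`.** `w` a finite place with `2 ∉ w`, `a ∉ w`; `r² = a`; then every `σ` in an inertia group
`I_𝔓`, `𝔓 ∣ w`, fixes `r` (it acts trivially modulo `𝔓`, and `σ r = −r` would put `2r` in `𝔓`).
[cite: NeukirchANT1999, Ch. I §9 (9.4)–(9.6)] [cite: IrelandRosen1990, Ch. 14 §2] -/
theorem smul_eq_self_of_mem_inertia_of_sq_eq {a : 𝓞 K} {w : HeightOneSpectrum (𝓞 K)} (h2 : (2 : 𝓞 K) ∉ w.asIdeal)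
    (ha : a ∉ w.asIdeal) {r : AlgebraicClosure K} (hr : r ^ 2 = algebraMap (𝓞 K) (AlgebraicClosure K) a)
    {𝔓 : Ideal (absIntegers (𝓞 K) K)} (h𝔓 : 𝔓 ∈ w.primesAbove) {σ : absoluteGaloisGroup K}
    (hσ : σ ∈ 𝔓.inertia (absoluteGaloisGroup K)) : σ • r = r := by
  have hri : IsIntegral (𝓞 K) r := IsIntegral.of_pow two_pos (by rw [hr]; exact isIntegral_algebraMap)
  set x : absIntegers (𝓞 K) K := ⟨r, hri⟩ with hxdef
  have hx : x ^ 2 = algebraMap (𝓞 K) (absIntegers (𝓞 K) K) a := Subtype.ext (by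
    change r ^ 2 = algebraMap (𝓞 K) (AlgebraicClosure K) a
    exact hr)
  rcases smul_eq_self_or_eq_neg_of_sq_eq hr σ with h | h
  · exact h
  · exfalso
    have hyx : σ • x - x ∈ 𝔓 := hσ x
    have hsx : σ • x = -x := Subtype.ext (by rw [integralClosure.coe_smul]; exact h)
    rw [hsx, show -x - x = -(2 * x) by ring, neg_mem_iff] at hyx
    exact two_mul_notMem_of_sq_eq h2 ha h𝔓 hx hyx

omit [NumberField K] in
/-- **The sign character is unramified away from `2a`**: a rank-one framed `g` with `g σ = 1` whenever `σ r = r` (as in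
`exists_framedGaloisRep_sign`) is unramified at every finite `w` with `2 ∉ w`, `a ∉ w`. [cite: SerreAbelianLadic1968, Ch. I §2.1] -/
theorem isUnramifiedAt_of_sign {A : Type*} [CommRing A] [TopologicalSpace A] {a : 𝓞 K} {w : HeightOneSpectrum (𝓞 K)}
    (h2 : (2 : 𝓞 K) ∉ w.asIdeal) (ha : a ∉ w.asIdeal) {r : AlgebraicClosure K}
    (hr : r ^ 2 = algebraMap (𝓞 K) (AlgebraicClosure K) a) {g : FramedGaloisRep K A 1}
    (hg : ∀ σ : absoluteGaloisGroup K, σ • r = r → g σ = 1) : g.IsUnramifiedAt w :=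
  fun _𝔓 h𝔓 σ hσ ↦ hg σ (smul_eq_self_of_mem_inertia_of_sq_eq h2 ha hr h𝔓 hσ)

/-! ## §4 Euler's criterion for Frobenius -/

omit [NumberField K] in
/-- **Frobenius on a square root = Euler's sign.** `w` a finite place with `2 ∉ w`, `a ∉ w`, `N w = 2k + 1`, and `s ∈ {1, −1}` with
`a^k ≡ s (mod w)`; `r² = a`. Then every arithmetic Frobenius `Φ` at a prime `𝔓 ∣ w` satisfies `Φ r = s·r`:
`Φ r ≡ r^{N w} = (r²)^k r = a^k r ≡ s r (mod 𝔓)`, both sides are `±r`, and `2r ∉ 𝔓`.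
[cite: IrelandRosen1990, Ch. 5 §1 Prop. 5.1.1 and Ch. 14 §2 Prop. 14.2.2] -/
theorem smul_eq_sign_smul_of_isArithFrobAt {a : 𝓞 K} {w : HeightOneSpectrum (𝓞 K)} (h2 : (2 : 𝓞 K) ∉ w.asIdeal)
    (ha : a ∉ w.asIdeal) {k : ℕ} (hk : Nat.card (𝓞 K ⧸ w.asIdeal) = 2 * k + 1) {s : ℤ} (hs : s = 1 ∨ s = -1)
    (hak : a ^ k - (s : 𝓞 K) ∈ w.asIdeal) {r : AlgebraicClosure K} (hr : r ^ 2 = algebraMap (𝓞 K) (AlgebraicClosure K) a)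
    {𝔓 : Ideal (absIntegers (𝓞 K) K)} (h𝔓 : 𝔓 ∈ w.primesAbove) {Φ : absoluteGaloisGroup K}
    (hΦ : IsArithFrobAt (𝓞 K) Φ 𝔓) : Φ • r = (s : K) • r := by
  haveI : 𝔓.IsPrime := h𝔓.1
  have hri : IsIntegral (𝓞 K) r := IsIntegral.of_pow two_pos (by rw [hr]; exact isIntegral_algebraMap)
  set x : absIntegers (𝓞 K) K := ⟨r, hri⟩ with hxdef
  have hx : x ^ 2 = algebraMap (𝓞 K) (absIntegers (𝓞 K) K) a := Subtype.ext (by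
    change r ^ 2 = algebraMap (𝓞 K) (AlgebraicClosure K) a
    exact hr)
  -- `Φ x ≡ x ^ N w (mod 𝔓)`
  have hcard : Nat.card (𝓞 K ⧸ Ideal.under (𝓞 K) 𝔓) = 2 * k + 1 := by rw [← h𝔓.2.over, hk]
  have hfrob : Φ • x - x ^ (2 * k + 1) ∈ 𝔓 := by
    have h := hΦ x
    rwa [MulSemiringAction.toAlgHom_apply, hcard] at h
  -- `x ^ (2k+1) = a^k x ≡ s x`
  have hpow : x ^ (2 * k + 1) = algebraMap (𝓞 K) (absIntegers (𝓞 K) K) (a ^ k) * x := by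
    rw [pow_succ, pow_mul, hx, map_pow]
  have hak' : algebraMap (𝓞 K) (absIntegers (𝓞 K) K) (a ^ k) * x - (s : absIntegers (𝓞 K) K) * x ∈ 𝔓 := by
    rw [← sub_mul, show (s : absIntegers (𝓞 K) K) = algebraMap (𝓞 K) (absIntegers (𝓞 K) K) (s : 𝓞 K) by simp, ← map_sub]
    exact 𝔓.mul_mem_right _ ((algebraMap_mem_iff_of_mem_primesAbove h𝔓 _).mpr hak)
  have hkey : Φ • x - (s : absIntegers (𝓞 K) K) * x ∈ 𝔓 := by
    have := 𝔓.add_mem hfrob hak'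
    rwa [hpow, sub_add_sub_cancel] at this
  -- compare with the two possible values `±x` of `Φ x`
  have hsK : ((s : K) • r : AlgebraicClosure K) = ((s : absIntegers (𝓞 K) K) * x : absIntegers (𝓞 K) K) := by
    rw [Subalgebra.coe_mul]
    simp [hxdef, Algebra.smul_def]
  rcases smul_eq_self_or_eq_neg_of_sq_eq hr Φ with h | h
  · -- `Φ r = r`: then `s = 1`, else `2x ∈ 𝔓`
    rcases hs with rfl | rfl
    · simp [h]
    · exfalso
      have hΦx : Φ • x = x := Subtype.ext (by rw [integralClosure.coe_smul]; exact h)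
      rw [hΦx, Int.cast_neg, Int.cast_one, neg_one_mul, sub_neg_eq_add, ← two_mul] at hkey
      exact two_mul_notMem_of_sq_eq h2 ha h𝔓 hx hkey
  · -- `Φ r = −r`: then `s = −1`, else `2x ∈ 𝔓`
    rcases hs with rfl | rfl
    · exfalso
      have hΦx : Φ • x = -x := Subtype.ext (by rw [integralClosure.coe_smul]; exact h)
      rw [hΦx, Int.cast_one, one_mul, show -x - x = -(2 * x) by ring, neg_mem_iff] at hkey
      exact two_mul_notMem_of_sq_eq h2 ha h𝔓 hx hkey
    · simp [h]

/-- **Framed form: the characteristic polynomial of Frobenius is `X − s`.** Under the hypotheses of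
`smul_eq_sign_smul_of_isArithFrobAt`, a rank-one framed `g` over `A` with entry `1` at the `σ` fixing `r` and `−1` at the others has
`g.HasFrobCharpolyAt w (X − C s)`. [cite: SerreAbelianLadic1968, Ch. I §2.1] [cite: IrelandRosen1990, Ch. 14 §2 Prop. 14.2.2] -/
theorem hasFrobCharpolyAt_of_sign {A : Type*} [CommRing A] [TopologicalSpace A] {a : 𝓞 K}
    {w : HeightOneSpectrum (𝓞 K)} (h2 : (2 : 𝓞 K) ∉ w.asIdeal) (ha : a ∉ w.asIdeal) {k : ℕ}
    (hk : Nat.card (𝓞 K ⧸ w.asIdeal) = 2 * k + 1) {s : ℤ} (hs : s = 1 ∨ s = -1) (hak : a ^ k - (s : 𝓞 K) ∈ w.asIdeal)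
    {r : AlgebraicClosure K} (hr : r ^ 2 = algebraMap (𝓞 K) (AlgebraicClosure K) a) {g : FramedGaloisRep K A 1}
    (hg : ∀ σ : absoluteGaloisGroup K, (σ • r = r → g σ = 1) ∧
      (σ • r = -r → ∀ i j : Fin 1, ((g σ : GL (Fin 1) A) : Matrix (Fin 1) (Fin 1) A) i j = -1)) :
    g.HasFrobCharpolyAt w (X - C (s : A)) := by
  rw [FramedGaloisRep.hasFrobCharpolyAt_iff_of_rank_one]
  intro 𝔓 h𝔓 Φ hΦ
  have hΦr := smul_eq_sign_smul_of_isArithFrobAt h2 ha hk hs hak hr h𝔓 hΦ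
  rcases hs with rfl | rfl
  · rw [Int.cast_one, one_smul] at hΦr
    rw [(hg Φ).1 hΦr, Int.cast_one, Units.val_one, Matrix.one_apply_eq]
  · rw [Int.cast_neg, Int.cast_one, neg_one_smul] at hΦr
    rw [(hg Φ).2 hΦr, Int.cast_neg, Int.cast_one]

end Summit.BirchSwinnertonDyer.BirchSwinnertonDyer.Theorems.PrintCf2.GoodTwistDictQuadSign

end
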